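import Mathlib
import HarnessLib
import Summits.PneNP.PneNP.Theorems.CnfIdealGenLengthRankDefectRepresentationsCutLemmaReciprocal

/-!
# Two obstructions around the cut lemma (line rank-dehn-ladder, stub `stub_cutLemma`)

Crux `stmt-PneNP-18923` (`Summit.PneNP.PneNP.Theses.CnfIdealGenLength.RankDefectRepresentations`), line `rank-dehn-ladder`,
negative rung N1 = `stub_cutLemma` (OPEN): if every coordinate cut `R ∘ 1[row_j ≠ col_j]` has rank `≤ t`, then `R` is within rank
`C (n+1)^a t` of SOME matrix `R'` supported on the same-colour cells `{row x = col y}`.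

THE PINCHING OBSTRUCTION (`pinching_obstruction`).  The obvious candidate `R' := R ∘ 1[row = col]` (the pinching of `R` to the
same-colour cells — the conditional expectation onto the commutant in the operator picture) does NOT work, not even qualitatively:
with rows and columns both coloured by all of `{0,1}^n` and `R = J − I` (`1` off the diagonal, `0` on it), every cut of `R` is the bare
crossing mask `1[x_j ≠ y_j]`, of rank `≤ 2`, the pinching of `R` is `0`, and `rank R = 2^n` (`R (R − (2^n − 2)) = (2^n − 1)·1`).  The
registered dist form survives because `R' = −I` is allowed: `R − R' = J` has rank `≤ 1` (`pinching_obstruction_dist`).  Consequently the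
colour-disjoint rectangle (where `R'` is forced to vanish) is the honest core of N1, and any induction on the colour bits that contracts a
bit must carry the freedom in `R'` (lead g6, `Lines/rank-dehn-ladder-g6-final.md` §2).
HONEST FRAMING: bookkeeping for one rung; the cut lemma, the crux and P ≠ NP are not touched; F-N2 is a FRONTIER formal rung.
-/

set_option linter.dupNamespace false -- `Summit.PneNP.PneNP.…`: summit = sub-problem name (D-0017)

namespace Summit.PneNP.PneNP.Theorems.CnfIdealGenLengthRankDefectRepresentationsCutLemmaObstructions

open Finset
open Summit.PneNP.PneNP.Theorems.CnfIdealGenLengthRankDefectRepresentationsCutLemmaReciprocal (rank_cutMask_le)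

variable {K : Type} [Field K] {n : ℕ}

/-- The square of `J − I` on a finite index type of size `N`: `(J − I)² = (N − 2)(J − I) + (N − 1)·1`, entrywise. -/
theorem offDiag_sq_apply {ι : Type} [Fintype ι] [DecidableEq ι] (x y : ι) :
    ((Matrix.of fun x y : ι => if x = y then (0 : K) else 1) * (Matrix.of fun x y : ι => if x = y then (0 : K) else 1)) x y
      = if x = y then (Fintype.card ι : K) - 1 else (Fintype.card ι : K) - 2 := by
  rw [Matrix.mul_apply]
  simp only [Matrix.of_apply]
  have h : ∀ z : ι, ((if x = z then (0 : K) else 1) * if z = y then 0 else 1) = if z ∈ (({x, y} : Finset ι)) then 0 else 1 := by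
    intro z
    by_cases hxz : x = z
    · subst hxz; simp
    · by_cases hzy : z = y
      · subst hzy; simp [hxz]
      · simp [hxz, hzy, Finset.mem_insert, Ne.symm hxz]
  simp_rw [h]
  rw [Finset.sum_ite, Finset.sum_const_zero, zero_add, Finset.sum_const, nsmul_eq_mul, mul_one]
  rw [Finset.filter_not, Finset.filter_mem_eq_inter, Finset.univ_inter, Finset.card_univ_sdiff]
  by_cases hxy : x = y
  · subst hxy
    have h1 : 1 ≤ Fintype.card ι := Fintype.card_pos_iff.mpr ⟨x⟩
    simp [Nat.cast_sub h1]
  · rw [if_neg hxy, Finset.card_pair hxy]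
    have h2 : 2 ≤ Fintype.card ι := by
      calc 2 = ({x, y} : Finset ι).card := (Finset.card_pair hxy).symm
        _ ≤ Fintype.card ι := Finset.card_le_univ _
    push_cast [Nat.cast_sub h2]
    ring

/-- `J − I` is invertible over a field in which `N − 1 ≠ 0` (`N` the size of the index type), hence has full rank `N`. -/
theorem rank_offDiag {ι : Type} [Fintype ι] [DecidableEq ι] (hN : (Fintype.card ι : K) - 1 ≠ 0) :
    (Matrix.of fun x y : ι => if x = y then (0 : K) else 1).rank = Fintype.card ι := by
  set R : Matrix ι ι K := Matrix.of fun x y : ι => if x = y then (0 : K) else 1 with hR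
  have hsq : R * R = ((Fintype.card ι : K) - 2) • R + ((Fintype.card ι : K) - 1) • (1 : Matrix ι ι K) := by
    ext x y
    rw [hR, offDiag_sq_apply]
    simp only [Matrix.add_apply, Matrix.smul_apply, Matrix.of_apply, Matrix.one_apply, smul_eq_mul]
    split_ifs <;> ring
  have hinv : R * (((Fintype.card ι : K) - 1)⁻¹ • (R - ((Fintype.card ι : K) - 2) • (1 : Matrix ι ι K))) = 1 := by
    rw [Matrix.mul_smul, Matrix.mul_sub, hsq, Matrix.mul_smul, Matrix.mul_one, add_sub_cancel_left, smul_smul,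
      inv_mul_cancel₀ hN, one_smul]
  have hU : IsUnit R := IsUnit.of_mul_eq_one _ hinv
  exact Matrix.rank_of_isUnit R hU

/-- **PINCHING OBSTRUCTION.**  Rows and columns both coloured by all of `{0,1}^n` (identity colourings) and `R = J − I`: every
coordinate cut of `R` has rank `≤ 2`, the pinching `R ∘ 1[row = col]` of `R` vanishes, yet `rank R = 2^n` as soon as `2^n − 1 ≠ 0`
in `K`.  So "`R` is close in rank to its pinching" fails exponentially, although the cut hypothesis of `stub_cutLemma` holds with
`t = 2`. -/
theorem pinching_obstruction (hN : ((2 : K) ^ n) - 1 ≠ 0) :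
    (∀ j : Fin n, (Matrix.of fun x y : Fin n → Bool =>
        if x j ≠ y j then (Matrix.of fun x y : Fin n → Bool => if x = y then (0 : K) else 1) x y else 0).rank ≤ 2) ∧
    (Matrix.of fun x y : Fin n → Bool =>
        if x = y then (Matrix.of fun x y : Fin n → Bool => if x = y then (0 : K) else 1) x y else 0) = 0 ∧
    (Matrix.of fun x y : Fin n → Bool => if x = y then (0 : K) else 1).rank = 2 ^ n := by
  refine ⟨fun j => ?_, ?_, ?_⟩
  · have h : (Matrix.of fun x y : Fin n → Bool =>
        if x j ≠ y j then (Matrix.of fun x y : Fin n → Bool => if x = y then (0 : K) else 1) x y else 0) =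
        Matrix.of fun x y : Fin n → Bool => if (fun z : Fin n → Bool => z) x j ≠ (fun z : Fin n → Bool => z) y j
          then (1 : K) else 0 := by
      ext x y
      simp only [Matrix.of_apply]
      by_cases hj : x j ≠ y j
      · have hxy : x ≠ y := fun h => hj (by rw [h])
        simp [hj, hxy]
      · simp [hj]
    rw [h]
    exact rank_cutMask_le (fun z : Fin n → Bool => z) (fun z : Fin n → Bool => z) j
  · ext x y
    simp only [Matrix.of_apply, Matrix.zero_apply]
    split_ifs <;> rfl
  · have hcard : (Fintype.card (Fin n → Bool) : K) = 2 ^ n := by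
      rw [Fintype.card_fun, Fintype.card_bool, Fintype.card_fin]; push_cast; rfl
    rw [rank_offDiag (by rw [hcard]; exact hN), Fintype.card_fun, Fintype.card_bool, Fintype.card_fin]

/-- … whereas the DIST form of the cut lemma is unharmed by this example: `R' = −1` is supported on the same-colour cells and
`R − R' = J` has rank `≤ 1`. -/
theorem pinching_obstruction_dist :
    (∀ x y : Fin n → Bool, x ≠ y → (-(1 : Matrix (Fin n → Bool) (Fin n → Bool) K)) x y = 0) ∧
    ((Matrix.of fun x y : Fin n → Bool => if x = y then (0 : K) else 1) -
        (-(1 : Matrix (Fin n → Bool) (Fin n → Bool) K))).rank ≤ 1 := by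
  refine ⟨fun x y hxy => by simp [hxy], ?_⟩
  have h : (Matrix.of fun x y : Fin n → Bool => if x = y then (0 : K) else 1) -
      (-(1 : Matrix (Fin n → Bool) (Fin n → Bool) K)) = Matrix.vecMulVec (fun _ => (1 : K)) (fun _ => 1) := by
    ext x y
    simp only [Matrix.sub_apply, Matrix.neg_apply, Matrix.of_apply, Matrix.one_apply, Matrix.vecMulVec_apply, mul_one]
    split_ifs <;> ring
  rw [h]
  exact Matrix.rank_vecMulVec_le _ _

/-! ## The certificate barrier on the full cube -/

/-- **CERTIFICATE BARRIER (full cube).**  On the identity colourings of `{0,1}^n` (rows = columns = all colours), ANY Hadamard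
certificate — weight matrices `W_j` and `E` with `(∑_j 1[x_j ≠ y_j] ∘ W_j) ⊙ E = J − I` (all ones off the diagonal) — costs
`2^n ≤ rank E · (2 · ∑_j rank W_j)`: for `J − I` has rank `2^n` (`rank_offDiag`) while a cut-masked `W_j` has rank `≤ 2 · rank W_j`.
Every universal tool of the line (first-differing coordinate, hybrids, reciprocal distances, character telescoping, group-algebra
decompositions) is a DIFFERENCE certificate `w_j(σ + τ)`, which extends from any colour pair with full difference set (random colourings)
to the full cube; so none of them can beat `2^{n-1}/n` on the affinely entangled core of N1 (`Lines/rank-dehn-ladder-A-problem.md` §11). -/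
theorem certificate_barrier_fullCube (hN : ((2 : K) ^ n) - 1 ≠ 0) (W : Fin n → Matrix (Fin n → Bool) (Fin n → Bool) K)
    (E : Matrix (Fin n → Bool) (Fin n → Bool) K)
    (hcert : ∀ x y : Fin n → Bool, (∑ j, if x j ≠ y j then W j x y else 0) * E x y = if x = y then 0 else 1) :
    2 ^ n ≤ E.rank * (2 * ∑ j, (W j).rank) := by
  classical
  -- `J − I = E ⊙ D` with `D` the weighted cut sum
  have hJI : (Matrix.of fun x y : Fin n → Bool => if x = y then (0 : K) else 1) =
      Matrix.hadamard E (∑ j, Matrix.hadamard (Matrix.of fun x y : Fin n → Bool => if x j ≠ y j then (1 : K) else 0) (W j)) := by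
    ext x y
    rw [Matrix.hadamard_apply, Matrix.sum_apply, Matrix.of_apply, ← hcert x y, mul_comm]
    congr 1
    refine Finset.sum_congr rfl fun j _ => ?_
    simp only [Matrix.hadamard_apply, Matrix.of_apply]
    split_ifs <;> simp
  have hrank := (pinching_obstruction (K := K) hN).2.2
  rw [hJI] at hrank
  rw [← hrank]
  refine (Literature.LinearAlgebra.Matrix.HadamardProductRank.rank_hadamard_le _ _).trans (Nat.mul_le_mul_left _ ?_)
  refine (Literature.Computability.AlgebraicComplexity.rank_sum_le _ _).trans ?_
  rw [Finset.mul_sum]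
  refine Finset.sum_le_sum fun j _ => ?_
  refine (Literature.LinearAlgebra.Matrix.HadamardProductRank.rank_hadamard_le _ _).trans (Nat.mul_le_mul_right _ ?_)
  exact rank_cutMask_le (fun z : Fin n → Bool => z) (fun z : Fin n → Bool => z) j

end Summit.PneNP.PneNP.Theorems.CnfIdealGenLengthRankDefectRepresentationsCutLemmaObstructions
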